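import Summits.CriticalPhenomena.PercolationContinuityZ3.Theorems.Transplant.Slab111SKGeo
import Mathlib.Combinatorics.SimpleGraph.Paths
import HarnessLib

/-!
# Small thickness `(111)`-films, IV: the cleared SET of a case and film PATHS from index data

builds on p205010 (kernel theorem, internal audit signed; external expert review pending) — NOT used in this file.  Lane `prim-bschramm`, seat
`prim-bschramm-p2` (gen 38; class C1b; memo `HOME/bschramm/P2-LATTICES.md` §136); helper file (`--supports stmt-CriticalPhenomena-4575 --as helper`).
* §1 **`Wset C z`** — the instance's cleared vertex set of the block at `z` (the vertices of the valid bits of the mask `C.W`), membership lemmas, and the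
  rerouting part `Wset ∩ \overline{blkR 3 z t_R s_R}` read from the mask `C.WR`;
* §2 **`gpath_of_idx`** — a validated index list (`AdjRel`-chain, no repetitions, valid) is a self-avoiding film path («VPathKit».`GPath`);
* §3 **`exists_branch_of_reach`** — a bit of `reach u R (bitOf b)` is joined to `vtx b` by a self-avoiding film path all of whose vertices are vertices
  of bits of `R` (index walk from «Slab111SKBits».`reach_sound` ↦ `SimpleGraph.Walk` ↦ `toPath`).
[cite: DuminilCopinSidoraviciusTassion2016, §2.3 (proof of Fact 2: the paths γ_u, γ_v, γ_w)]
-/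

noncomputable section

namespace Summit.CriticalPhenomena.PercolationContinuityZ3.Theorems.Transplant

open Literature.Probability.Percolation Literature.Probability.LatticeModels SimpleGraph
open scoped Classical

namespace Slab111.SK

variable {C : Ctx} {z : Site 2}

/-! ## §1 The cleared set -/

/-- **The cleared vertex set of the case at the block centre `z`**: the film vertices of the valid bits of `C.W`. [folklore] -/
def Wset (C : Ctx) (z : Site 2) : Set (slab111 C.k) := {x | ∃ i, C.validB i = true ∧ C.W.testBit i = true ∧ vtx C.k z i = x}

/-- Membership of an index vertex in the cleared set. [folklore] -/
theorem vtx_mem_Wset_iff (hz : ClassHyp C z) {i : ℕ} (hv : C.validB i = true) : vtx C.k z i ∈ Wset C z ↔ C.W.testBit i = true := by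
  constructor
  · rintro ⟨j, hj, hW, he⟩
    rw [vtx_inj hz hj hv he] at hW; exact hW
  · intro h; exact ⟨i, hv, h, rfl⟩

/-- A member of the cleared set is an index vertex. [folklore] -/
theorem exists_idx_of_mem_Wset {x : slab111 C.k} (h : x ∈ Wset C z) : ∃ i, C.validB i = true ∧ C.W.testBit i = true ∧ vtx C.k z i = x := h

/-- **The rerouting mask reads `Wset ∩ \overline{blkR 3 z t_R s_R}`.** [folklore] -/
theorem testBit_WR_iff_mem (hz : ClassHyp C z) {i : ℕ} (hv : C.validB i = true) {tR sR : ℕ} (htR : C.tR = min tR 3) (hsR : C.sR = min sR 3) :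
    C.WR.testBit i = true ↔ vtx C.k z i ∈ Wset C z ∩ (hexShadow C.k).lift (blkR 3 z tR sR) := by
  rw [testBit_WR_iff, Set.mem_inter_iff, vtx_mem_Wset_iff hz hv, HexShadow.mem_lift, hexShadow_sh, inRB_iff_mem_blkR hz hv htR hsR]

/-- Every bit of `W` is valid when `W` lies inside an allowed mask of valid bits. [folklore] -/
theorem validB_of_W {allowed forced : ℕ} (hW : C.wOK allowed forced = true) (hall : ∀ i, allowed.testBit i = true → C.validB i = true) {i : ℕ}
    (h : C.W.testBit i = true) : C.validB i = true := by
  simp only [Ctx.wOK, Bool.and_eq_true] at hW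
  exact hall i (testBit_of_sdiff_beq hW.1 h)

/-! ## §2 Film paths from validated index lists -/

/-- **A validated index list is a self-avoiding film path.** [folklore] -/
theorem gpath_of_idx (hz : ClassHyp C z) {l : List ℕ} (hne : l ≠ []) (hv : ∀ x ∈ l, C.validB x = true) (hch : l.IsChain AdjRel)
    (hnd : l.Nodup) : GPath (film C.k) (l.map (vtx C.k z)) (vtx C.k z (l.head hne)) (vtx C.k z (l.getLast hne)) where
  ne_nil := by simpa using hne
  chain := by
    rw [List.isChain_map]
    exact hch.imp_of_mem_imp fun a b ha hb hab => adj_vtx hz (hv a ha) (hv b hb) hab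
  nodup := hnd.map_on fun a ha b hb hab => vtx_inj hz (hv a ha) (hv b hb) hab
  head := by rw [List.head?_map, List.head?_eq_some_head hne]; rfl
  last := by rw [List.getLast?_map, List.getLast?_eq_some_getLast hne]; rfl

/-- With known end points. [folklore] -/
theorem gpath_of_idx' (hz : ClassHyp C z) {l : List ℕ} {s t : ℕ} (hv : ∀ x ∈ l, C.validB x = true) (hch : l.IsChain AdjRel) (hnd : l.Nodup)
    (hs : l.head? = some s) (ht : l.getLast? = some t) : GPath (film C.k) (l.map (vtx C.k z)) (vtx C.k z s) (vtx C.k z t) := by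
  have hne : l ≠ [] := by rintro rfl; simp at hs
  have h1 : l.head hne = s := by rw [List.head?_eq_some_head hne, Option.some.injEq] at hs; exact hs
  have h2 : l.getLast hne = t := by rw [List.getLast?_eq_some_getLast hne, Option.some.injEq] at ht; exact ht
  rw [← h1, ← h2]; exact gpath_of_idx hz hne hv hch hnd

/-- Membership read-back for mapped index lists. [folklore] -/
theorem mem_map_vtx_iff (hz : ClassHyp C z) {l : List ℕ} (hv : ∀ x ∈ l, C.validB x = true) {j : ℕ} (hj : C.validB j = true) :
    vtx C.k z j ∈ l.map (vtx C.k z) ↔ j ∈ l := by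
  rw [List.mem_map]
  constructor
  · rintro ⟨i, hi, he⟩; rw [← vtx_inj hz (hv i hi) hj he]; exact hi
  · intro h; exact ⟨j, h, rfl⟩

/-! ## §3 The branch from reachability -/

/-- A film walk along an index walk. [folklore] -/
theorem exists_walk_of_chain (hz : ClassHyp C z) (R : ℕ) (hR : ∀ i, R.testBit i = true → C.validB i = true) :
    ∀ (l : List ℕ) (s : ℕ), (s :: l).IsChain AdjRel → (∀ x ∈ s :: l, R.testBit x = true) →
      ∃ p : (film C.k).Walk (vtx C.k z s) (vtx C.k z (walkEnd s l)), ∀ v ∈ p.support, ∃ j ∈ s :: l, vtx C.k z j = v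
  | [], s, _, _ => by
    refine ⟨Walk.nil, fun v hv => ⟨s, by simp, ?_⟩⟩
    exact (Walk.mem_support_nil_iff.mp hv).symm
  | j :: l, s, hch, hmem => by
    obtain ⟨hsj, hch'⟩ := List.isChain_cons_cons.1 hch
    obtain ⟨p, hp⟩ := exists_walk_of_chain hz R hR l j hch' fun x hx => hmem x (List.mem_cons_of_mem _ hx)
    have hadj : (film C.k).Adj (vtx C.k z s) (vtx C.k z j) :=
      adj_vtx hz (hR _ (hmem s (by simp))) (hR _ (hmem j (by simp))) hsj
    have he : walkEnd s (j :: l) = walkEnd j l := rfl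
    rw [he]
    refine ⟨Walk.cons hadj p, fun v hv => ?_⟩
    rw [Walk.support_cons, List.mem_cons] at hv
    rcases hv with rfl | hv
    · exact ⟨s, by simp, rfl⟩
    · obtain ⟨i, hi, rfl⟩ := hp v hv
      exact ⟨i, List.mem_cons_of_mem _ hi, rfl⟩

/-- **THE BRANCH FROM REACHABILITY**: a bit `w` of `reach u R (bitOf b)` (all bits of `R` valid) is joined to `vtx b` by a self-avoiding film path whose
vertices are vertices of bits of `R`. [cite: DuminilCopinSidoraviciusTassion2016, §2.3 (proof of Fact 2: the path γ_w)] -/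
theorem exists_branch_of_reach (hz : ClassHyp C z) {u R b w : ℕ} (hR : ∀ i, R.testBit i = true → C.validB i = true)
    (h : (reach u R (bitOf b)).testBit w = true) :
    ∃ Br : List (slab111 C.k), GPath (film C.k) Br (vtx C.k z b) (vtx C.k z w) ∧
      ∀ x ∈ Br, ∃ j, C.validB j = true ∧ R.testBit j = true ∧ vtx C.k z j = x := by
  obtain ⟨s, l, hs, hRs, hw, he⟩ := reach_sound h
  rw [testBit_bitOf] at hs
  simp only [decide_eq_true_eq] at hs
  subst hs
  obtain ⟨p, hp⟩ := exists_walk_of_chain hz R hR l b hw.1 hw.2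
  subst he
  have hsub := Walk.support_toPath_subset_support p
  generalize p.toPath = q at hsub
  obtain ⟨q, hqpath⟩ := q
  refine ⟨q.support, ⟨q.support_ne_nil, q.isChain_adj_support, hqpath.support_nodup, ?_, ?_⟩, ?_⟩
  · rw [List.head?_eq_some_head q.support_ne_nil, Walk.head_support]
  · rw [List.getLast?_eq_some_getLast q.support_ne_nil, Walk.getLast_support]
  · intro x hx
    obtain ⟨j, hj, rfl⟩ := hp x (hsub hx)
    exact ⟨j, hR _ (hw.2 j hj), hw.2 j hj, rfl⟩

end Slab111.SK

end Summit.CriticalPhenomena.PercolationContinuityZ3.Theorems.Transplant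

end
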